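import Summits.BirchSwinnertonDyer.Rank1Residual.X2.DualRestrictionInvariants
import Literature.NumberTheory.EllipticCurves.IwasawaSelmerIsTorsionProofs
import Literature.NumberTheory.EllipticCurves.SharpFlatPAdicLFunctionCoeffField
import HarnessLib

/-!
# Route `SignedLowerHalves`, crux L `SmallImageLowerHalfBothSigns` (stmt-BirchSwinnertonDyer-23599), line `rtt_w3` v13 — E2, row (6′) E2-K JUNCTION, LEAD:
# THE INDEX IDENTITY `λ(H ⧸ ∙z) + λ(ker eH) = λ(H' ⧸ ∙z') + λ(coker eH)` (NO quasi-isomorphism, NO pseudo-null input)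

WHY (BRIEF-E2 rev 3.1 §3 row (6′); LEAD design note rev 3.2). The junction map `eH : Hsp → ker gX` (specialisation `H¹₂/f ↪ 𝐇¹(K^cyc_∞)` followed by
`π ∘ loc_v`) need NOT have finite cokernel: `coker ⊇ H²₂[f]`, which is finite only if `H²₂` has no pseudo-null submodule meeting `(f)`. The robust junction is
BOOKKEEPING: for any `Λ`-linear `e : H' → H` and `A' ≤ H'` with `A' ⊓ ker e = ⊥`, the four-term exact sequence `0 → ker e → H'/A' → H/e(A') → H/e(H') → 0`
gives `λ(H ⧸ e(A')) + λ(ker e) = λ(H' ⧸ A') + λ(H ⧸ range e)` (`lambdaInvariant_quotient_map_add_ker_eq`); with `A' = Λ_𝒪∙z'`, `z = e z'` non-torsion this is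
`λ(H ⧸ Λ_𝒪∙z) + λ(ker e) = λ(H' ⧸ Λ_𝒪∙z') + λ(coker e)` (`lambdaInvariant_quotient_span_add_ker_eq`). Road D's slack is exactly `λ(H²₂[f])`
(`λ(Hsp ⧸ ∙ζ̄) + λ(H²₂[f]) = λ(Ysp)` in equality form), and `λ(coker eH) − λ(ker eH) = λ(H²₂[f]) − λ(𝐒)` (composite index), so `hK` follows with NO
finiteness of `H²₂[f]` and NO vanishing of the compact Selmer kernel `𝐒`. THEOREMS ONLY (kernel commutative algebra). [cite: Washington1997, §13.2] [folklore]
-/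

set_option linter.dupNamespace false -- D-0017: single-problem summit, the namespace repeats the problem name by design
set_option autoImplicit false

noncomputable section

namespace Summit.BirchSwinnertonDyer.BirchSwinnertonDyer.Theorems.SmallImageRttCharRoad

open Literature.NumberTheory.EllipticCurves

universe u v

variable {p : ℕ} [Fact p.Prime]

section Lambda

variable {H' : Type u} {H : Type v} [AddCommGroup H'] [Module (IwasawaAlgebra p) H'] [AddCommGroup H] [Module (IwasawaAlgebra p) H]

/-- Torsion transports along a linear equivalence. [folklore] -/
theorem isTorsion_of_linearEquiv {R : Type*} [CommRing R] {M : Type u} {N : Type v} [AddCommGroup M] [Module R M] [AddCommGroup N] [Module R N]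
    (e : M ≃ₗ[R] N) (hM : Module.IsTorsion R M) : Module.IsTorsion R N := fun {x} ↦ by
  obtain ⟨a, ha⟩ := @hM (e.symm x)
  refine ⟨a, ?_⟩
  change (a : R) • e.symm x = 0 at ha
  change (a : R) • x = 0
  have h := congrArg e ha
  rwa [LinearEquiv.map_smul, LinearEquiv.apply_symm_apply, LinearEquiv.map_zero] at h

/-- **The four-term index identity.** `e : H' → H` `Λ`-linear, `A' ≤ H'` with `A' ⊓ ker e = ⊥`, `H' ⧸ A'` and `H ⧸ e(A')` finitely generated torsion: then
`λ(H ⧸ e(A')) + λ(ker e) = λ(H' ⧸ A') + λ(H ⧸ range e)`, from the exact sequence `0 → ker e → H' ⧸ A' → H ⧸ e(A') → H ⧸ e(H') → 0`.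
[cite: Washington1997, §13.2] [folklore] -/
theorem lambdaInvariant_quotient_map_add_ker_eq (e : H' →ₗ[IwasawaAlgebra p] H) (A' : Submodule (IwasawaAlgebra p) H')
    (hmeet : A' ⊓ LinearMap.ker e = ⊥) [Module.Finite (IwasawaAlgebra p) (H' ⧸ A')] (ht' : Module.IsTorsion (IwasawaAlgebra p) (H' ⧸ A'))
    [Module.Finite (IwasawaAlgebra p) (H ⧸ A'.map e)] (ht : Module.IsTorsion (IwasawaAlgebra p) (H ⧸ A'.map e)) :
    lambdaInvariant p (H ⧸ A'.map e) + lambdaInvariant p (LinearMap.ker e) =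
      lambdaInvariant p (H' ⧸ A') + lambdaInvariant p (H ⧸ LinearMap.range e) := by
  -- the maps `q̄ : H'/A' → H/e(A')` and `c : H/e(A') → H/e(H')`
  let qbar : (H' ⧸ A') →ₗ[IwasawaAlgebra p] (H ⧸ A'.map e) := A'.mapQ (A'.map e) e (Submodule.le_comap_map e A')
  have hle : A'.map e ≤ LinearMap.range e := LinearMap.map_le_range
  let c : (H ⧸ A'.map e) →ₗ[IwasawaAlgebra p] (H ⧸ LinearMap.range e) :=
    (A'.map e).mapQ (LinearMap.range e) LinearMap.id (by simpa using hle)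
  have hc : Function.Surjective c := by
    intro y
    induction y using Submodule.Quotient.induction_on with
    | H x => exact ⟨Submodule.Quotient.mk x, rfl⟩
  -- `ker c = range q̄`
  have hkc : LinearMap.ker c = LinearMap.range qbar := by
    refine le_antisymm ?_ ?_
    · intro y hy
      induction y using Submodule.Quotient.induction_on with
      | H x =>
        have hx : x ∈ LinearMap.range e := by
          rw [LinearMap.mem_ker] at hy
          exact (Submodule.Quotient.mk_eq_zero _).mp hy
        obtain ⟨x', rfl⟩ := LinearMap.mem_range.mp hx
        exact ⟨Submodule.Quotient.mk x', rfl⟩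
    · rintro _ ⟨y, rfl⟩
      induction y using Submodule.Quotient.induction_on with
      | H x' =>
        rw [LinearMap.mem_ker]
        change Submodule.Quotient.mk (LinearMap.id (e x')) = (0 : H ⧸ LinearMap.range e)
        exact (Submodule.Quotient.mk_eq_zero _).mpr (LinearMap.mem_range_self e x')
  -- `ker q̄ ≃ ker e`
  have hi_mem : ∀ x : LinearMap.ker e, A'.mkQ (x : H') ∈ LinearMap.ker qbar := fun x ↦ by
    rw [LinearMap.mem_ker]
    change Submodule.Quotient.mk (e (x : H')) = (0 : H ⧸ A'.map e)
    rw [LinearMap.map_coe_ker, Submodule.Quotient.mk_zero]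
  let i : LinearMap.ker e →ₗ[IwasawaAlgebra p] LinearMap.ker qbar :=
    LinearMap.codRestrict _ (A'.mkQ ∘ₗ (LinearMap.ker e).subtype) hi_mem
  have hi : Function.Bijective i := by
    constructor
    · intro x y hxy
      have h : A'.mkQ (x : H') = A'.mkQ (y : H') := congrArg Subtype.val hxy
      rw [Submodule.mkQ_apply, Submodule.mkQ_apply, Submodule.Quotient.eq] at h
      have hk : (x : H') - y ∈ LinearMap.ker e := Submodule.sub_mem _ x.2 y.2
      have h0 : (x : H') - y ∈ A' ⊓ LinearMap.ker e := ⟨h, hk⟩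
      rw [hmeet, Submodule.mem_bot, sub_eq_zero] at h0
      exact Subtype.ext h0
    · rintro ⟨y, hy⟩
      induction y using Submodule.Quotient.induction_on with
      | H x' =>
        have hx' : e x' ∈ A'.map e := by
          rw [LinearMap.mem_ker] at hy
          exact (Submodule.Quotient.mk_eq_zero _).mp hy
        obtain ⟨a, ha, hax⟩ := Submodule.mem_map.mp hx'
        have hk : x' - a ∈ LinearMap.ker e := by rw [LinearMap.mem_ker, map_sub, hax, sub_self]
        refine ⟨⟨x' - a, hk⟩, Subtype.ext ?_⟩
        change A'.mkQ (x' - a) = Submodule.Quotient.mk x'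
        rw [Submodule.mkQ_apply, Submodule.Quotient.eq, sub_sub_cancel_left]
        exact A'.neg_mem ha
  -- the λ-bookkeeping
  have h1 := Summit.BirchSwinnertonDyer.Rank1Residual.X2.DualRestrictionInvariants.lambdaInvariant_eq_add_of_surjective p c ht hc
  have h2 := Summit.BirchSwinnertonDyer.Rank1Residual.X2.DualRestrictionInvariants.lambdaInvariant_eq_add_of_surjective p
    qbar.rangeRestrict ht' (LinearMap.surjective_rangeRestrict qbar)
  have h3 : lambdaInvariant p (LinearMap.ker qbar.rangeRestrict) = lambdaInvariant p (LinearMap.ker e) :=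
    (lambdaInvariant_eq_of_linearEquiv ((LinearEquiv.ofEq _ _ (LinearMap.ker_rangeRestrict qbar)).trans
      (LinearEquiv.ofBijective i hi).symm))
  have h4 : lambdaInvariant p (LinearMap.range qbar) = lambdaInvariant p (LinearMap.ker c) :=
    lambdaInvariant_eq_of_linearEquiv (LinearEquiv.ofEq _ _ hkc.symm)
  rw [h1, h2, h3, h4]
  ring

end Lambda

section LambdaO

variable {S : Set (PadicAlgCl p)} [Algebra (IwasawaAlgebra p) (IwasawaAlgebraO S)]
  {H' : Type u} {H : Type v} [AddCommGroup H'] [Module (IwasawaAlgebraO S) H'] [Module (IwasawaAlgebra p) H']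
  [IsScalarTower (IwasawaAlgebra p) (IwasawaAlgebraO S) H']
  [AddCommGroup H] [Module (IwasawaAlgebraO S) H] [Module (IwasawaAlgebra p) H] [IsScalarTower (IwasawaAlgebra p) (IwasawaAlgebraO S) H]

/-- **The junction index identity for cyclic `Λ_𝒪`-spans.** `eH : H' → H` `Λ_𝒪`-linear, `eH z' = z` with `l • z = 0 ⇒ l • z' = 0` (e.g. `z` non-torsion),
`H' ⧸ Λ_𝒪∙z'` and `H ⧸ Λ_𝒪∙z` finitely generated torsion over `Λ`: then
`λ(H ⧸ Λ_𝒪∙z) + λ(ker eH) = λ(H' ⧸ Λ_𝒪∙z') + λ(H ⧸ range eH)`. In E2 (`H' = Hsp`, `z' = ζ̄`, `H = ker gX`): combined with road D in equality form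
(`λ(Hsp ⧸ ∙ζ̄) + λ(H²₂[f]) = λ(Ysp)`) and `λ(coker eH) ≤ λ(ker eH) + λ(H²₂[f])`, it yields the glue's `hK`. [cite: Washington1997, §13.2] [folklore] -/
theorem lambdaInvariant_quotient_span_add_ker_eq (eH : H' →ₗ[IwasawaAlgebraO S] H) (z' : H') (z : H) (heH : eH z' = z)
    (hmeet : ∀ l : IwasawaAlgebraO S, l • z = 0 → l • z' = 0)
    [Module.Finite (IwasawaAlgebra p) (H' ⧸ Submodule.span (IwasawaAlgebraO S) {z'})]
    (ht' : Module.IsTorsion (IwasawaAlgebra p) (H' ⧸ Submodule.span (IwasawaAlgebraO S) {z'}))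
    [Module.Finite (IwasawaAlgebra p) (H ⧸ Submodule.span (IwasawaAlgebraO S) {z})]
    (ht : Module.IsTorsion (IwasawaAlgebra p) (H ⧸ Submodule.span (IwasawaAlgebraO S) {z})) :
    lambdaInvariant p (H ⧸ Submodule.span (IwasawaAlgebraO S) {z}) + lambdaInvariant p (LinearMap.ker (eH.restrictScalars (IwasawaAlgebra p))) =
      lambdaInvariant p (H' ⧸ Submodule.span (IwasawaAlgebraO S) {z'}) + lambdaInvariant p (H ⧸ LinearMap.range eH) := by
  set e := eH.restrictScalars (IwasawaAlgebra p) with he_def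
  set A' : Submodule (IwasawaAlgebra p) H' := (Submodule.span (IwasawaAlgebraO S) {z'}).restrictScalars (IwasawaAlgebra p) with hA'
  -- `e(A') = Λ_𝒪∙z` (as `Λ`-submodules)
  have hmap : A'.map e = (Submodule.span (IwasawaAlgebraO S) {z}).restrictScalars (IwasawaAlgebra p) := by
    refine Submodule.ext fun x ↦ ⟨fun hx ↦ ?_, fun hx ↦ ?_⟩
    · obtain ⟨y, hy, rfl⟩ := Submodule.mem_map.mp hx
      rw [hA', Submodule.restrictScalars_mem, Submodule.mem_span_singleton] at hy
      obtain ⟨l, rfl⟩ := hy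
      rw [Submodule.restrictScalars_mem, Submodule.mem_span_singleton]
      exact ⟨l, by rw [he_def, LinearMap.restrictScalars_apply, map_smul, heH]⟩
    · rw [Submodule.restrictScalars_mem, Submodule.mem_span_singleton] at hx
      obtain ⟨l, rfl⟩ := hx
      refine Submodule.mem_map.mpr ⟨l • z', ?_, ?_⟩
      · rw [hA', Submodule.restrictScalars_mem]
        exact Submodule.smul_mem _ l (Submodule.mem_span_singleton_self z')
      · rw [he_def, LinearMap.restrictScalars_apply, map_smul, heH]
  -- `A' ⊓ ker e = ⊥`
  have hmeet' : A' ⊓ LinearMap.ker e = ⊥ := by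
    refine (Submodule.eq_bot_iff _).mpr fun x hx ↦ ?_
    obtain ⟨hxA, hxk⟩ := Submodule.mem_inf.mp hx
    rw [hA', Submodule.restrictScalars_mem, Submodule.mem_span_singleton] at hxA
    obtain ⟨l, rfl⟩ := hxA
    rw [LinearMap.mem_ker, he_def, LinearMap.restrictScalars_apply, map_smul, heH] at hxk
    exact hmeet l hxk
  -- the quotients by restricted-scalar submodules are the same `Λ`-modules
  let εH' : (H' ⧸ A') ≃ₗ[IwasawaAlgebra p] (H' ⧸ Submodule.span (IwasawaAlgebraO S) {z'}) :=
    Submodule.Quotient.restrictScalarsEquiv (IwasawaAlgebra p) _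
  let εH : (H ⧸ A'.map e) ≃ₗ[IwasawaAlgebra p] (H ⧸ Submodule.span (IwasawaAlgebraO S) {z}) :=
    (Submodule.quotEquivOfEq _ _ hmap).trans (Submodule.Quotient.restrictScalarsEquiv (IwasawaAlgebra p) _)
  haveI : Module.Finite (IwasawaAlgebra p) (H' ⧸ A') := Module.Finite.equiv εH'.symm
  haveI : Module.Finite (IwasawaAlgebra p) (H ⧸ A'.map e) := Module.Finite.equiv εH.symm
  have key := lambdaInvariant_quotient_map_add_ker_eq e A' hmeet' (isTorsion_of_linearEquiv εH'.symm ht') (isTorsion_of_linearEquiv εH.symm ht)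
  rw [lambdaInvariant_eq_of_linearEquiv εH, lambdaInvariant_eq_of_linearEquiv εH'] at key
  -- `H ⧸ range e` vs `H ⧸ range eH`
  have hr : LinearMap.range e = (LinearMap.range eH).restrictScalars (IwasawaAlgebra p) := LinearMap.range_restrictScalars eH
  rw [lambdaInvariant_eq_of_linearEquiv ((Submodule.quotEquivOfEq _ _ hr).trans
    (Submodule.Quotient.restrictScalarsEquiv (IwasawaAlgebra p) (LinearMap.range eH)))] at key
  exact key

end LambdaO

end Summit.BirchSwinnertonDyer.BirchSwinnertonDyer.Theorems.SmallImageRttCharRoad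

end
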